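import Literature.NumberTheory.EllipticCurves.PAdicMeasureMomentFiltration
import Mathlib.Algebra.Polynomial.Eval.Degree
import HarnessLib

/-!
# Greenberg's Lemma 2, lower-triangular case, and the `Σ₀(p)`-stability of the filtration `F^N 𝔻⁰_k`

Continuation of `PAdicMeasureMomentFiltration`.  For a lower-triangular matrix `γ = (1 0; c 1)` with
`c ∈ pℤ_p` the moments of `μ |_k γ` are

  `m_m(μ|γ) = ∫ z^m (1 + cz)^{k-m} dμ`;

for `m ≤ k` this is a combination of `m_m, …, m_k` (`moment_weightActD_lower_eq_sum`), and for
`m = k + j` the integrand `z^{k+j} (1 + cz)^{-j}` is, up to an error of sup-norm `≤ p^{-M}`, the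
polynomial `z^{k+j} Q_M(-cz)` with `Q_M = (Σ_{n<M} Xⁿ)^j ∈ ℤ[X]` (`norm_inv_pow_sub_poly_le`) — this
replaces Greenberg's power-series identity (4) by a finite computation plus the estimate
`‖∫ f dμ‖ ≤ ‖f‖_sup` for `μ ∈ 𝔻⁰`.  Consequences:

* **Greenberg's Lemma 2, lower-triangular case** (`weightActD_lower_mem_filG`): `F^N 𝔻⁰_k` is stable
  under `(1 0; c 1)`, `‖c‖ < 1`;
* with the upper-triangular case (`weightActD_upper_mem_filG`) and the factorisation
  `(a b; c d) = (1 0; c/a 1)(a b; 0 Δ/a)` in `Σ₀(p)` (`weightActD_factor`), **`F^N 𝔻⁰_k` is stable under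
  the whole weight-`k` action of `Σ₀(p)`** (`weightActD_mem_filG`) — so the finite-level approximation
  modules `A^N = 𝔻⁰/F^N` inherit the action (Greenberg 2007, §3).

Brick B2i' of the bottom-up plan recorded with the named fact
`greenbergStevens_kitagawa_twoVariable_interpolation_allBranches`.  Everything is proved; no named facts.

## References

* M. Greenberg, *Lifting modular symbols of non-critical slope*, Israel J. Math. 161 (2007), §3,
  Lemma 2. [Greenberg2007Lifting]
-/

noncomputable section

open Filter Topology Polynomial

namespace Literature.NumberTheory.EllipticCurves

variable {p : ℕ} [Fact p.Prime]

open BoundedDistribution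

/-! ### Norm bookkeeping in `ℤ_p` -/

section Norms

/-- In `ℤ_p`, `‖c‖ < 1` means `‖c‖ ≤ p⁻¹`. [folklore] -/
theorem norm_le_zpow_neg_one_of_norm_lt_one {c : ℤ_[p]} (hc : ‖c‖ < 1) : ‖c‖ ≤ (p : ℝ) ^ (-(1 : ℤ)) := by
  rw [PadicInt.norm_le_pow_iff_norm_lt_pow_add_one]; simpa using hc

/-- `‖cⁿ‖ ≤ p^{-n}` for `‖c‖ < 1`. [folklore] -/
theorem norm_pow_le_of_norm_lt_one {c : ℤ_[p]} (hc : ‖c‖ < 1) (n : ℕ) : ‖c ^ n‖ ≤ (p : ℝ) ^ (-(n : ℤ)) := by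
  rw [norm_pow]
  calc ‖c‖ ^ n ≤ ((p : ℝ) ^ (-(1 : ℤ))) ^ n := pow_le_pow_left₀ (norm_nonneg _) (norm_le_zpow_neg_one_of_norm_lt_one hc) n
    _ = (p : ℝ) ^ (-(n : ℤ)) := by rw [← zpow_natCast, ← zpow_mul]; congr 1; ring

end Norms

/-! ### The lower-triangular Möbius map and automorphy factor -/

section Lower

variable {c : ℤ_[p]} (hc : ‖c‖ < 1)

/-- The inverse automorphy factor `x(z) = (1 + cz)⁻¹ ∈ ℤ_p`. [folklore] -/
def invAut (z : ℤ_[p]) : ℤ_[p] := ((autFactor norm_one hc z)⁻¹ : ℤ_[p]ˣ)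

/-- `(1 + cz) · x(z) = 1`. [folklore] -/
theorem one_add_mul_mul_invAut (z : ℤ_[p]) : (1 + c * z) * invAut hc z = 1 := by
  rw [invAut, ← coe_autFactor norm_one hc z, Units.mul_inv]

/-- `‖x(z)‖ = 1`. [folklore] -/
theorem norm_invAut (z : ℤ_[p]) : ‖invAut hc z‖ = 1 := PadicInt.isUnit_iff.mp (Units.isUnit _)

/-- For `γ = (1 0; c 1)` the Möbius map is `γ·z = z · x(z)`. [folklore] -/
theorem moebius_lower (z : ℤ_[p]) : moebius norm_one hc 0 1 z = z * invAut hc z := by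
  have h := autFactor_mul_moebius norm_one hc 0 1 z
  rw [zero_add, one_mul] at h
  have hu : IsUnit (1 + c * z) := by
    rw [← coe_autFactor norm_one hc z]; exact Units.isUnit _
  refine hu.mul_left_cancel ?_
  rw [h, mul_left_comm, one_add_mul_mul_invAut, mul_one]

/-- `x(z)` is uniformly continuous. [folklore] -/
theorem uniformContinuous_invAut : UniformContinuous (invAut hc) := by
  have h : invAut hc = fun z => moebius norm_one hc 1 0 z := by
    funext z
    have h1 := autFactor_mul_moebius norm_one hc 1 0 z
    rw [zero_mul, add_zero] at h1
    have hu : IsUnit (1 + c * z) := by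
      rw [← coe_autFactor norm_one hc z]; exact Units.isUnit _
    exact hu.mul_left_cancel (by rw [one_add_mul_mul_invAut, h1])
  rw [h]
  exact uniformContinuous_moebius norm_one hc 1 0

/-- **The integrand of `m_m(μ |_k γ)` for lower-triangular `γ`**: `(γ·z)^m (1 + cz)^k = z^m x(z)^m (1+cz)^k`,
which for `m = k + j` is `z^{k+j} x(z)^j` and for `m + i = k` is `z^m (1 + cz)^i`. [folklore] -/
theorem moebius_pow_mul_autPow_lower_high (k j : ℕ) (z : ℤ_[p]) :
    (moebius norm_one hc 0 1 z : ℚ_[p]) ^ (k + j) * autPow (𝕜 := ℚ_[p]) k 1 c z =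
      ((z ^ (k + j) * invAut hc z ^ j : ℤ_[p]) : ℚ_[p]) := by
  rw [autPow_apply, Algebra.algebraMap_self, RingHom.id_apply, moebius_lower hc, ← PadicInt.coe_pow, ← PadicInt.coe_mul]
  congr 1
  have h2 : invAut hc z ^ k * (1 + c * z) ^ k = 1 := by
    rw [← mul_pow, mul_comm, one_add_mul_mul_invAut, one_pow]
  calc (z * invAut hc z) ^ (k + j) * (1 + c * z) ^ k
      = z ^ (k + j) * invAut hc z ^ j * (invAut hc z ^ k * (1 + c * z) ^ k) := by ring
    _ = z ^ (k + j) * invAut hc z ^ j := by rw [h2, mul_one]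

/-- The low-moment integrand: for `m + i = k`, `(γ·z)^m (1 + cz)^k = z^m (1 + cz)^i`. [folklore] -/
theorem moebius_pow_mul_autPow_lower_low (m i : ℕ) (z : ℤ_[p]) :
    (moebius norm_one hc 0 1 z : ℚ_[p]) ^ m * autPow (𝕜 := ℚ_[p]) (m + i) 1 c z =
      ((z ^ m * (1 + c * z) ^ i : ℤ_[p]) : ℚ_[p]) := by
  rw [autPow_apply, Algebra.algebraMap_self, RingHom.id_apply, moebius_lower hc, ← PadicInt.coe_pow, ← PadicInt.coe_mul]
  congr 1
  have h2 : invAut hc z ^ m * (1 + c * z) ^ m = 1 := by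
    rw [← mul_pow, mul_comm, one_add_mul_mul_invAut, one_pow]
  calc (z * invAut hc z) ^ m * (1 + c * z) ^ (m + i)
      = z ^ m * (1 + c * z) ^ i * (invAut hc z ^ m * (1 + c * z) ^ m) := by ring
    _ = z ^ m * (1 + c * z) ^ i := by rw [h2, mul_one]

end Lower

/-! ### The polynomial approximation of `(1 + cz)^{-j}` -/

section Poly

variable {c : ℤ_[p]} (hc : ‖c‖ < 1)

/-- The truncated geometric series approximates `x(z) = (1 + cz)⁻¹` to order `M`:
`x(z) − Σ_{n<M} (−cz)ⁿ = x(z) (−cz)^M`. [folklore] -/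
theorem invAut_sub_geom_sum (M : ℕ) (z : ℤ_[p]) :
    invAut hc z - ∑ n ∈ Finset.range M, (-(c * z)) ^ n = invAut hc z * (-(c * z)) ^ M := by
  have h1 : (1 + c * z) * invAut hc z = 1 := one_add_mul_mul_invAut hc z
  have hg := geom_sum_mul_neg (-(c * z)) M
  rw [show (1 : ℤ_[p]) - -(c * z) = 1 + c * z by ring] at hg
  -- multiply the claim by the unit `1 + cz`
  have hu : IsUnit (1 + c * z) := by rw [← coe_autFactor norm_one hc z]; exact Units.isUnit _
  refine hu.mul_left_cancel ?_
  rw [mul_sub, h1, ← mul_assoc, h1, one_mul, mul_comm (1 + c * z), hg, sub_sub_cancel]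

/-- `‖x(z)^j − (Σ_{n<M} (−cz)ⁿ)^j‖ ≤ p^{-M}`. [folklore] -/
theorem norm_invAut_pow_sub_geom_sum_pow_le (j M : ℕ) (z : ℤ_[p]) :
    ‖invAut hc z ^ j - (∑ n ∈ Finset.range M, (-(c * z)) ^ n) ^ j‖ ≤ (p : ℝ) ^ (-(M : ℤ)) := by
  have h := (Commute.all (invAut hc z) (∑ n ∈ Finset.range M, (-(c * z)) ^ n)).geom_sum₂_mul j
  rw [← h, norm_mul, invAut_sub_geom_sum hc M z, norm_mul, norm_invAut, one_mul]
  calc ‖∑ i ∈ Finset.range j, invAut hc z ^ i * (∑ n ∈ Finset.range M, (-(c * z)) ^ n) ^ (j - 1 - i)‖ * ‖(-(c * z)) ^ M‖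
      ≤ 1 * (p : ℝ) ^ (-(M : ℤ)) := by
        refine mul_le_mul (PadicInt.norm_le_one _) ?_ (norm_nonneg _) zero_le_one
        rw [neg_pow, norm_mul, norm_pow, norm_neg, norm_one, one_pow, one_mul, mul_pow, norm_mul]
        calc ‖c ^ M‖ * ‖z ^ M‖ ≤ (p : ℝ) ^ (-(M : ℤ)) * 1 :=
            mul_le_mul (norm_pow_le_of_norm_lt_one hc M) (PadicInt.norm_le_one _) (norm_nonneg _) (by positivity)
          _ = _ := mul_one _
    _ = (p : ℝ) ^ (-(M : ℤ)) := one_mul _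

/-- The integer polynomial `Q_{M,j} = (Σ_{n<M} Xⁿ)^j`. [folklore] -/
def geomSumPow (M j : ℕ) : ℤ[X] := (∑ n ∈ Finset.range M, X ^ n) ^ j

/-- `Q_{M,j}(q) = (Σ_{n<M} qⁿ)^j`. [folklore] -/
theorem eval₂_geomSumPow {S : Type*} [CommRing S] (f : ℤ →+* S) (M j : ℕ) (q : S) :
    (geomSumPow M j).eval₂ f q = (∑ n ∈ Finset.range M, q ^ n) ^ j := by
  rw [geomSumPow, eval₂_pow, eval₂_finsetSum]
  simp [eval₂_pow, eval₂_X]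

/-- `Q_{M,j}(q)` as a finite sum of monomials `Σ_n a_n qⁿ` with integer coefficients. [folklore] -/
theorem geom_sum_pow_eq_sum_coeff (M j : ℕ) (q : ℤ_[p]) :
    (∑ n ∈ Finset.range M, q ^ n) ^ j =
      ∑ n ∈ Finset.range ((geomSumPow M j).natDegree + 1), ((geomSumPow M j).coeff n : ℤ_[p]) * q ^ n := by
  rw [← eval₂_geomSumPow (Int.castRingHom ℤ_[p]) M j q, eval₂_eq_sum_range]
  rfl

end Poly

/-! ### Moments of `μ |_k (1 0; c 1)` -/

section LowerMoments

variable {c : ℤ_[p]} (hc : ‖c‖ < 1)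

/-- **Low moments**: for `m + i = k`, `m_m(μ|γ) = Σ_l C(i,l) c^l m_{m+l}(μ)`. [cite: Greenberg2007Lifting, proof of Lemma 2] -/
theorem moment_weightActD_lower_low (m i : ℕ) (μ : (ProfiniteTower.padicInt p).distributions ℚ_[p]) :
    moment (weightActD p ℚ_[p] (m + i) norm_one hc 0 1 μ).1 m =
      ∑ l ∈ Finset.range (i + 1), ((i.choose l : ℕ) : ℚ_[p]) * (c : ℚ_[p]) ^ l * moment μ.1 (m + l) := by
  set D := ProfiniteTower.toBounded μ.2 with hD
  rw [moment_def, integralFn_weightActD (m + i) norm_one hc 0 1 μ (uniformContinuous_coe_pow m)]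
  change D.integral (fun z => (moebius norm_one hc 0 1 z : ℚ_[p]) ^ m * autPow (𝕜 := ℚ_[p]) (m + i) 1 c z) = _
  simp_rw [moebius_pow_mul_autPow_lower_low hc m i]
  have hexp : ∀ z : ℤ_[p], ((z ^ m * (1 + c * z) ^ i : ℤ_[p]) : ℚ_[p]) =
      ∑ l ∈ Finset.range (i + 1), ((i.choose l : ℕ) : ℚ_[p]) * (c : ℚ_[p]) ^ l * (z : ℚ_[p]) ^ (m + l) := fun z => by
    push_cast
    rw [add_comm (1 : ℚ_[p]), add_pow, Finset.mul_sum]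
    refine Finset.sum_congr rfl fun l _ => ?_
    rw [one_pow, mul_one, pow_add]; ring
  simp_rw [hexp]
  rw [D.integral_finset_sum _ fun l _ => CompactSpace.uniformContinuous_of_continuous (by fun_prop)]
  refine Finset.sum_congr rfl fun l _ => ?_
  rw [D.integral_const_mul _ (uniformContinuous_coe_pow (m + l))]
  rfl

/-- **High moments, polynomial part**: `∫ z^{k+j} Q_{M,j}(−cz) dμ = Σ_n a_n (−c)ⁿ m_{k+j+n}(μ)`. [folklore] -/
theorem integral_pow_mul_geomSumPow (k j M : ℕ) (D : BoundedDistribution (ProfiniteTower.padicInt p) ℚ_[p]) :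
    D.integral (fun z : ℤ_[p] => (((z ^ (k + j) * (∑ n ∈ Finset.range M, (-(c * z)) ^ n) ^ j : ℤ_[p])) : ℚ_[p])) =
      ∑ n ∈ Finset.range ((geomSumPow M j).natDegree + 1),
        (((geomSumPow M j).coeff n : ℤ) : ℚ_[p]) * ((-c : ℤ_[p]) : ℚ_[p]) ^ n *
          (ProfiniteTower.padicInt p).integralFn D.μ (fun z => (z : ℚ_[p]) ^ (k + j + n)) := by
  have hexp : ∀ z : ℤ_[p], (((z ^ (k + j) * (∑ n ∈ Finset.range M, (-(c * z)) ^ n) ^ j : ℤ_[p])) : ℚ_[p]) =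
      ∑ n ∈ Finset.range ((geomSumPow M j).natDegree + 1),
        (((geomSumPow M j).coeff n : ℤ) : ℚ_[p]) * ((-c : ℤ_[p]) : ℚ_[p]) ^ n * (z : ℚ_[p]) ^ (k + j + n) := fun z => by
    rw [geom_sum_pow_eq_sum_coeff M j, Finset.mul_sum, PadicInt.coe_sum]
    refine Finset.sum_congr rfl fun n _ => ?_
    push_cast
    ring
  simp_rw [hexp]
  rw [D.integral_finset_sum _ fun n _ => CompactSpace.uniformContinuous_of_continuous (by fun_prop)]
  refine Finset.sum_congr rfl fun n _ => ?_
  rw [D.integral_const_mul _ (uniformContinuous_coe_pow (k + j + n))]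
  rfl

/-- **High moments of `μ|γ` for `μ ∈ F^N`**: `‖m_{k+j}(μ |_k (1 0; c 1))‖ ≤ p^{j-1-N}` (`j ≥ 1`).
[cite: Greenberg2007Lifting, Lemma 2] -/
theorem norm_moment_weightActD_lower_high {k N : ℕ} (μ : (ProfiniteTower.padicInt p).distributions ℚ_[p])
    (hμ : μ.1 ∈ filG p k N) {j : ℕ} (hj : 1 ≤ j) :
    ‖moment (weightActD p ℚ_[p] k norm_one hc 0 1 μ).1 (k + j)‖ ≤ (p : ℝ) ^ ((j : ℤ) - 1 - N) := by
  have hp1 : (1 : ℝ) < p := by exact_mod_cast (Fact.out : p.Prime).one_lt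
  set D := (ProfiniteTower.padicInt p).toBounded₁ hμ.1 with hD
  have hpos : (0 : ℝ) ≤ (p : ℝ) ^ ((j : ℤ) - 1 - N) := by positivity
  -- the integrand and its polynomial approximation
  set M := N + 1 with hM
  set f : ℤ_[p] → ℚ_[p] := fun z => ((z ^ (k + j) * invAut hc z ^ j : ℤ_[p]) : ℚ_[p]) with hf
  set g : ℤ_[p] → ℚ_[p] := fun z => (((z ^ (k + j) * (∑ n ∈ Finset.range M, (-(c * z)) ^ n) ^ j : ℤ_[p])) : ℚ_[p]) with hg
  have hf_uc : UniformContinuous f :=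
    CompactSpace.uniformContinuous_of_continuous (by
      have := (uniformContinuous_invAut hc).continuous
      rw [hf]; fun_prop)
  have hg_uc : UniformContinuous g := CompactSpace.uniformContinuous_of_continuous (by rw [hg]; fun_prop)
  have hfg : ∀ z, ‖f z - g z‖ ≤ (p : ℝ) ^ (-(M : ℤ)) := fun z => by
    rw [hf, hg]
    dsimp only
    rw [← PadicInt.coe_sub, PadicInt.padic_norm_e_of_padicInt, ← mul_sub, norm_mul]
    calc ‖z ^ (k + j)‖ * ‖invAut hc z ^ j - (∑ n ∈ Finset.range M, (-(c * z)) ^ n) ^ j‖ ≤ 1 * (p : ℝ) ^ (-(M : ℤ)) :=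
        mul_le_mul (PadicInt.norm_le_one _) (norm_invAut_pow_sub_geom_sum_pow_le hc j M z) (norm_nonneg _) zero_le_one
      _ = _ := one_mul _
  -- the moment is `∫ f dμ`
  have hmom : moment (weightActD p ℚ_[p] k norm_one hc 0 1 μ).1 (k + j) = D.integral f := by
    rw [moment_def, integralFn_weightActD k norm_one hc 0 1 μ (uniformContinuous_coe_pow (k + j))]
    change (ProfiniteTower.toBounded μ.2).integral
      (fun z => (moebius norm_one hc 0 1 z : ℚ_[p]) ^ (k + j) * autPow (𝕜 := ℚ_[p]) k 1 c z) = D.integral f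
    simp_rw [moebius_pow_mul_autPow_lower_high hc k j]
    exact BoundedDistribution.integral_congr_μ rfl _
  -- split `∫ f = ∫ g + ∫ (f - g)`
  have hsplit : D.integral f = D.integral g + D.integral (fun z => f z - g z) := by
    rw [← D.integral_add hg_uc (hf_uc.sub hg_uc)]
    exact congr_arg D.integral (funext fun z => by ring)
  rw [hmom, hsplit]
  refine (IsUltrametricDist.norm_add_le_max _ _).trans (max_le ?_ ?_)
  · -- the polynomial part: finite sum of moments
    rw [hg, integral_pow_mul_geomSumPow k j M D]
    refine IsUltrametricDist.norm_sum_le_of_forall_le_of_nonneg hpos fun n _ => ?_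
    have h1 : ‖(((geomSumPow M j).coeff n : ℤ) : ℚ_[p])‖ ≤ 1 := by
      rw [← PadicInt.coe_intCast, PadicInt.padic_norm_e_of_padicInt]; exact PadicInt.norm_le_one _
    have h2 : ‖((-c : ℤ_[p]) : ℚ_[p]) ^ n‖ ≤ (p : ℝ) ^ (-(n : ℤ)) := by
      rw [← PadicInt.coe_pow, PadicInt.padic_norm_e_of_padicInt, neg_pow, norm_mul, norm_pow, norm_neg, norm_one, one_pow,
        one_mul]
      exact norm_pow_le_of_norm_lt_one hc n
    have h3 : ‖(ProfiniteTower.padicInt p).integralFn D.μ (fun z => (z : ℚ_[p]) ^ (k + j + n))‖ ≤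
        (p : ℝ) ^ (((k + j + n : ℕ) : ℤ) - k - 1 - N) := norm_moment_le_of_mem_filG hμ (k + j + n)
    have hp0 : (0 : ℝ) ≤ (p : ℝ) ^ (-(n : ℤ)) := by positivity
    rw [norm_mul, norm_mul]
    calc ‖(((geomSumPow M j).coeff n : ℤ) : ℚ_[p])‖ * ‖((-c : ℤ_[p]) : ℚ_[p]) ^ n‖ *
          ‖(ProfiniteTower.padicInt p).integralFn D.μ (fun z => (z : ℚ_[p]) ^ (k + j + n))‖
        ≤ 1 * (p : ℝ) ^ (-(n : ℤ)) * (p : ℝ) ^ (((k + j + n : ℕ) : ℤ) - k - 1 - N) := by gcongr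
      _ = (p : ℝ) ^ ((j : ℤ) - 1 - N) := by
          rw [one_mul, ← zpow_add₀ (by positivity)]
          congr 1; push_cast; ring
  · -- the remainder: sup-norm `≤ p^{-M}` against a measure of norm `≤ 1`
    have h := D.norm_integral_le (hf_uc.sub hg_uc) (by positivity) hfg
    rw [ProfiniteTower.toBounded₁_bound, one_mul] at h
    exact h.trans (zpow_le_zpow_right₀ hp1.le (by rw [hM]; push_cast; omega))

/-- **Greenberg's Lemma 2, lower-triangular case: `F^N 𝔻⁰_k` is stable under `(1 0; c 1)`, `‖c‖ < 1`.**
[cite: Greenberg2007Lifting, Lemma 2] -/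
theorem weightActD_lower_mem_filG (k N : ℕ) (μ : (ProfiniteTower.padicInt p).distributions ℚ_[p]) (hμ : μ.1 ∈ filG p k N) :
    (weightActD p ℚ_[p] k norm_one hc 0 1 μ).1 ∈ filG p k N := by
  refine ⟨weightActD_mem_distributionsInt k norm_one hc 0 1 μ hμ.1, fun m hm => ?_, fun j hj =>
    norm_moment_weightActD_lower_high hc μ hμ hj⟩
  obtain ⟨i, rfl⟩ := Nat.exists_eq_add_of_le hm
  rw [moment_weightActD_lower_low hc m i μ]
  refine Finset.sum_eq_zero fun l hl => ?_
  rw [hμ.2.1 (m + l) (by have := Finset.mem_range.mp hl; omega), mul_zero]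

end LowerMoments

/-! ### Full `Σ₀(p)`-stability by the triangular factorisation -/

section Sigma0

/-- Congruence for `weightActD` in its matrix entries (which carry proofs); local copy of the lemma in
`ModularSymbolsDistributionCoefficients`. [folklore] -/
private theorem weightActD_congr' (k : ℕ) {a c a' c' b d b' d' : ℤ_[p]} (ha : ‖a‖ = 1) (hc : ‖c‖ < 1)
    (ha' : ‖a'‖ = 1) (hc' : ‖c'‖ < 1) (h1 : a = a') (h2 : b = b') (h3 : c = c') (h4 : d = d') :
    weightActD p ℚ_[p] k ha hc b d = weightActD p ℚ_[p] k ha' hc' b' d' := by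
  subst h1 h2 h3 h4; rfl

/-- **The triangular factorisation of the weight-`k` action**: for `γ = (a b; c d) ∈ Σ₀(p)`,
`μ |_k γ = (μ |_k (1 0; c/a 1)) |_k (a b; 0 (ad - bc)/a)`. [cite: Greenberg2007Lifting, proof of Lemma 2] -/
theorem weightActD_factor (k : ℕ) {a c : ℤ_[p]} (ha : ‖a‖ = 1) (hc : ‖c‖ < 1) (b d : ℤ_[p]) :
    ∃ (a' : ℤ_[p]) (hc' : ‖c * a'‖ < 1), a * a' = 1 ∧
      weightActD p ℚ_[p] k ha hc b d =
        (weightActD p ℚ_[p] k ha norm_zero_lt_one' b ((a * d - b * c) * a')).comp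
          (weightActD p ℚ_[p] k norm_one hc' 0 1) := by
  have hau : IsUnit a := PadicInt.isUnit_iff.mpr ha
  obtain ⟨u, rfl⟩ := hau
  refine ⟨((u⁻¹ : ℤ_[p]ˣ) : ℤ_[p]), ?_, u.mul_inv, ?_⟩
  · rw [norm_mul]
    calc ‖c‖ * ‖((u⁻¹ : ℤ_[p]ˣ) : ℤ_[p])‖ ≤ ‖c‖ * 1 := mul_le_mul_of_nonneg_left (PadicInt.norm_le_one _) (norm_nonneg _)
      _ < 1 := by rw [mul_one]; exact hc
  · have hc' : ‖c * ((u⁻¹ : ℤ_[p]ˣ) : ℤ_[p])‖ < 1 := by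
      rw [norm_mul]
      calc ‖c‖ * ‖((u⁻¹ : ℤ_[p]ˣ) : ℤ_[p])‖ ≤ ‖c‖ * 1 := mul_le_mul_of_nonneg_left (PadicInt.norm_le_one _) (norm_nonneg _)
        _ < 1 := by rw [mul_one]; exact hc
    have hui : (u : ℤ_[p]) * ((u⁻¹ : ℤ_[p]ˣ) : ℤ_[p]) = 1 := u.mul_inv
    -- the product `(1 0; c/a 1) (a b; 0 Δ/a)` has entries `(a, b; c, d)`
    have hA : ‖(1 : ℤ_[p]) * u + 0 * 0‖ = 1 := by rw [one_mul, mul_zero, add_zero]; exact ha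
    have hC : ‖c * ((u⁻¹ : ℤ_[p]ˣ) : ℤ_[p]) * u + 1 * 0‖ < 1 := by
      rw [mul_assoc, u.inv_mul, mul_one, mul_zero, add_zero]; exact hc
    have hmul := weightActD_mul (𝕜 := ℚ_[p]) k norm_one hc' ha norm_zero_lt_one' 0 1 b ((u * d - b * c) * ((u⁻¹ : ℤ_[p]ˣ) : ℤ_[p]))
      hA hC
    rw [← hmul]
    apply weightActD_congr'
    · rw [one_mul, mul_zero, add_zero]
    · rw [one_mul, zero_mul, add_zero]
    · rw [mul_assoc, u.inv_mul, mul_one, mul_zero, add_zero]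
    · have : c * ((u⁻¹ : ℤ_[p]ˣ) : ℤ_[p]) * b + 1 * ((u * d - b * c) * ((u⁻¹ : ℤ_[p]ˣ) : ℤ_[p])) = d := by
        have h2 : ((u⁻¹ : ℤ_[p]ˣ) : ℤ_[p]) * u = 1 := u.inv_mul
        linear_combination d * h2
      rw [this]

/-- **`F^N 𝔻⁰_k` is stable under the weight-`k` action of `Σ₀(p)`** (Greenberg 2007, Lemma 2, for
measures). [cite: Greenberg2007Lifting, Lemma 2] -/
theorem weightActD_mem_filG (k N : ℕ) {a c : ℤ_[p]} (ha : ‖a‖ = 1) (hc : ‖c‖ < 1) (b d : ℤ_[p])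
    (μ : (ProfiniteTower.padicInt p).distributions ℚ_[p]) (hμ : μ.1 ∈ filG p k N) :
    (weightActD p ℚ_[p] k ha hc b d μ).1 ∈ filG p k N := by
  obtain ⟨a', hc', -, hfac⟩ := weightActD_factor k ha hc b d
  rw [hfac, LinearMap.comp_apply]
  exact weightActD_upper_mem_filG k N ha b _ _ (weightActD_lower_mem_filG hc' k N μ hμ)

end Sigma0

end Literature.NumberTheory.EllipticCurves

end
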